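import Summits.BirchSwinnertonDyer.BirchSwinnertonDyer.Theorems.PrintCf2RamifiedOffTYZTheoremAHilbertBridge
import Literature.NumberTheory.EllipticCurves.HeegnerPointsShimuraReciprocityHoldsProofs
import Literature.NumberTheory.EllipticCurves.HeegnerPointsClassesProofs
import Literature.NumberTheory.EllipticCurves.ModularParametrizationDegree
import Literature.NumberTheory.EllipticCurves.XZeroThirtyTwoEtaCoordinates
import HarnessLib

/-!
# Route `PrintCf2`, crux stmt-BirchSwinnertonDyer-20509 `RamifiedOffTYZOfFacts`, THEOREM A's target (T2), the HEEGNER half: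
# `Gal(H/K)` acts FREELY on a Heegner point of level `32` and conductor `1` in `A(H)` — granted the display `x032_φ_injective`
# (cell `bsd-print-cf2`, LEAD cruxlead-20509 g33, line `offtyz-v7`, lineage cycle 34; Theses-free, `def`-free; conditional on ONE display of v12's print door)

HONEST FRAMING (`--supports stmt-BirchSwinnertonDyer-20509`; theorems only, no `sorry`, no new named fact).  BSD is not proved by any of this;
no class is closed by this file; item 23431 (C⁺) and crux 20509 stay OPEN.  Shimura reciprocity on the Heegner points of conductor `1` is a tree
THEOREM (`heegnerPoints_shimuraReciprocity_holds`: `Cl ≅ Gal(H_K/K)` acts on the lifts `P_q ∈ A(H_K)`, `q ∈ reps`, by translation of the form class);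
the display `x032_φ_injective` (Yang 2006: `(X, Y) : X₀(32) ⥲ A`) makes distinct representatives give distinct points; so the stabiliser of a Heegner point
in `Gal(H_K/K)` is trivial.  Through the bridge `H ≃ H_K` compatible with `e` (`TheoremAHilbertBridge.exists_algEquiv_coe_eq`, p813131) the same holds
for the point of `A(H)` over `Dt.φ(τ_Q)`, `H ⊆ rayClassField K 𝔪`.

* `exists_algEquiv_singularModuliField_coe_eq` — the bridge with target `singularModuliField K ι` (`= ringClassField K ι 1`) instead of `K[1]`;
* `isGamma0Equiv_of_φ_eq` — `Dt.φ(τ_Q) = Dt.φ(τ_{Q'}) ⟹ Q ∼_{Γ₀(32)} Q'` (the display); `φ_eq_of_isGamma0Equiv` — the converse (`φ` is `Γ₀(32)`-invariant);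
* ★★ `algEquiv_eq_one_of_map_point_eq` — **`σ ∈ Gal(H/K)` fixing the point of `A(H)` over `Dt.φ(τ_Q)` is `1`** (`K` imaginary quadratic satisfying the
  Heegner hypothesis for `32`, `Q` a Heegner form of level `32` and discriminant `d_K`).

References: [cite: Darmon2004, Thm. 3.6, Thm. 3.7]; [cite: Gross1984, §I.1]; [cite: Yang2006DefiningEquations, §4.1 Table row N = 32]; tree
`heegnerPoints_shimuraReciprocity_holds`, `exists_heegnerDatum`, p813131.
-/

noncomputable section

open scoped Classical
open NumberField

namespace Summit.BirchSwinnertonDyer.PrintCf2.TheoremAHeegnerFree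

open Literature.NumberTheory.EllipticCurves Literature.NumberTheory.EllipticCurves.ModularForms Literature.NumberTheory.NumberFields
open Literature.NumberTheory.EllipticCurves.TianYuanZhang2017 (curveA)
open Summit.BirchSwinnertonDyer.PrintCf2.TheoremAHilbertBridge

variable {K : Type} [Field K] [NumberField K]

/-! ## §1 The bridge onto `singularModuliField K ι` -/

/-- For subfields `S = T` of a field, `Subfield.inclusion` is a bijection (ABSTRACT subfields). [folklore] -/
theorem bijective_subfieldInclusion_of_eq {L : Type*} [Field L] {S T : Subfield L} (h : S = T) :
    Function.Bijective (Subfield.inclusion h.le) := by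
  subst h
  exact ⟨fun x y hxy => Subtype.ext (congrArg Subtype.val hxy), fun y => ⟨y, Subtype.ext rfl⟩⟩

/-- ★ The bridge `φ : H ≃ₐ[K] H_K = singularModuliField K ι` with `(φ h : ℂ) = e h` on `H ⊆ rayClassField K 𝔪`. [cite: Cox2013, Cor. 11.34] -/
theorem exists_algEquiv_singularModuliField_coe_eq (hK : IsImaginaryQuadratic K) (ι : K →+* ℂ) {𝔪 : Ideal (𝓞 K)} (h𝔪 : 𝔪 ≠ ⊥)
    (e : rayClassField K 𝔪 →+* ℂ) (he : ∀ k : K, e (algebraMap K (rayClassField K 𝔪) k) = ι k) :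
    ∃ ψ : hilbertClassField K ≃ₐ[K] singularModuliField K ι,
      ∀ h : hilbertClassField K, ((ψ h : singularModuliField K ι) : ℂ) = e (IntermediateField.inclusion (hilbertClassField_le_rayClassField h𝔪) h) := by
  obtain ⟨φ, hφ⟩ := exists_algEquiv_coe_eq hK ι h𝔪 e he
  have h1 : ringClassField K ι 1 = singularModuliField K ι := ringClassField_one ι
  let f : ringClassField K ι 1 →+* singularModuliField K ι := Subfield.inclusion h1.le
  have hf : ∀ x, ((f x : singularModuliField K ι) : ℂ) = (x : ℂ) := fun x => coe_subfieldInclusion h1.le x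
  let fe : ringClassField K ι 1 ≃ₐ[K] singularModuliField K ι :=
    AlgEquiv.ofBijective
      { toRingHom := f
        commutes' := fun k => Subtype.ext (by
          rw [RingHom.toFun_eq_coe, hf, coe_algebraMap_ringClassField, coe_algebraMap_singularModuliField]) }
      (bijective_subfieldInclusion_of_eq h1)
  refine ⟨φ.trans fe, fun h => ?_⟩
  rw [AlgEquiv.trans_apply, ← hφ h]
  exact hf (φ h)

/-! ## §2 `φ(τ_Q) = φ(τ_{Q'}) ⟺ Q ∼ Q'` -/

/-- **`Dt.φ(τ_Q) = Dt.φ(τ_{Q'}) ⟹ Q ∼_{Γ₀(32)} Q'`** for a degree-one datum — the display `x032_φ_injective`.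
[cite: Yang2006DefiningEquations, §4.1 Table row N = 32] -/
theorem isGamma0Equiv_of_φ_eq (hInj : x032_φ_injective) (Dt : ModularParametrizationData curveA 32) (hdeg : Dt.modularDegree = 1)
    {Q Q' : ℤ × ℤ × ℤ} (h : Dt.φ (heegnerTau Q) = Dt.φ (heegnerTau Q')) : IsGamma0Equiv 32 Q Q' := by
  obtain ⟨γ, hγ, hτ⟩ := hInj Dt hdeg _ _ h
  exact ⟨⟨γ, hγ⟩, hτ.symm⟩

/-- `Q ∼_{Γ₀(N)} Q' ⟹ Dt.φ(τ_Q) = Dt.φ(τ_{Q'})` (`φ` is `Γ₀(N)`-invariant). [cite: CremonaAlgorithms1997, §2.10] -/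
theorem φ_eq_of_isGamma0Equiv {N : ℕ} [NeZero N] {W : WeierstrassCurve ℚ} [W.IsElliptic] (Dt : ModularParametrizationData W N)
    {Q Q' : ℤ × ℤ × ℤ} (h : IsGamma0Equiv N Q Q') : Dt.φ (heegnerTau Q) = Dt.φ (heegnerTau Q') := by
  obtain ⟨γ, hγ⟩ := h
  rw [← hγ, Dt.φ_gamma0_smul_holds']

/-! ## §3 Freeness -/

/-- Pushing a point along `σ` then along `ψ` is pushing it along `ψ ∘ σ` (ABSTRACT fields). [folklore] -/
theorem map_map_algHom {A B C : Type*} [Field A] [Field B] [Field C] [Algebra ℚ A] [Algebra ℚ B] [Algebra ℚ C]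
    [Algebra K A] [Algebra K B] [Algebra K C] [IsScalarTower ℚ K A] [IsScalarTower ℚ K B] [IsScalarTower ℚ K C]
    (W : WeierstrassCurve ℚ) (f : A →ₐ[K] B) (g : B →ₐ[K] C) (P : (W.baseChange A).toAffine.Point) :
    WeierstrassCurve.Affine.Point.map g (WeierstrassCurve.Affine.Point.map (W' := W) f P) =
      WeierstrassCurve.Affine.Point.map (W' := W) (g.comp f) P := by
  rw [WeierstrassCurve.Affine.Point.map_map]

/-- Pushing along a `K`-algebra hom `f` equals pushing along `u : A → ℂ` when their values agree (ABSTRACT fields). [folklore] -/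
theorem map_eq_map_of_apply_eq {A B : Type*} [Field A] [Field B] [Algebra ℚ A] [Algebra ℚ B] [Algebra K A] [Algebra K B]
    [IsScalarTower ℚ K A] [IsScalarTower ℚ K B] (W : WeierstrassCurve ℚ)
    (f : A →ₐ[K] B) (v : B →+* ℂ) (u : A →+* ℂ) (hfu : ∀ a, v (f a) = u a) (P : (W.baseChange A).toAffine.Point) :
    WeierstrassCurve.Affine.Point.map v.toRatAlgHom (WeierstrassCurve.Affine.Point.map (W' := W) f P) =
      WeierstrassCurve.Affine.Point.map u.toRatAlgHom P := by
  rcases P with _ | ⟨x, y, hxy⟩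
  · rfl
  · simp only [WeierstrassCurve.Affine.Point.map_some]
    congr 1 <;> simp [hfu]

/-- ★★ **`Gal(H/K)` acts freely on a Heegner point of level `32`, conductor `1`.**  For `K` imaginary quadratic with the Heegner hypothesis for `32`,
`ι : K → ℂ`, `𝔪 ≠ 0`, `e : rayClassField K 𝔪 → ℂ` over `ι`, a degree-one datum `Dt` of `curveA` (so `Dt.φ = ±(X, Y)`), a Heegner form `Q` of level `32`
and discriminant `d_K`, and a point `P ∈ A(H)` with `e(P) = Dt.φ(τ_Q)`: every `σ ∈ Gal(H/K)` with `σ P = P` is `1`.  GRANTED the display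
`x032_φ_injective`. [cite: Darmon2004, Thm. 3.7] [cite: Gross1984, §I.1] [cite: Yang2006DefiningEquations, §4.1 Table row N = 32] -/
theorem algEquiv_eq_one_of_map_point_eq (hInj : x032_φ_injective) (hK : IsImaginaryQuadratic K) (hSH : SatisfiesHeegnerHypothesis 32 K)
    (ι : K →+* ℂ) {𝔪 : Ideal (𝓞 K)} (h𝔪 : 𝔪 ≠ ⊥) (e : rayClassField K 𝔪 →+* ℂ) (he : ∀ k : K, e (algebraMap K (rayClassField K 𝔪) k) = ι k)
    (Dt : ModularParametrizationData curveA 32) (hdeg : Dt.modularDegree = 1)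
    {Q : ℤ × ℤ × ℤ} (hQ : Q ∈ heegnerForms 32 (NumberField.discr K))
    (P : (curveA.baseChange (hilbertClassField K)).toAffine.Point)
    (hP : WeierstrassCurve.Affine.Point.map (e.comp (IntermediateField.inclusion (hilbertClassField_le_rayClassField h𝔪)).toRingHom).toRatAlgHom P =
      Dt.φ (heegnerTau Q))
    (σ : hilbertClassField K ≃ₐ[K] hilbertClassField K)
    (hσ : WeierstrassCurve.Affine.Point.map (W' := curveA) (σ : hilbertClassField K →ₐ[K] hilbertClassField K) P = P) : σ = 1 := by
  -- a Heegner datum with residue `B`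
  have hβ : (4 * (32 : ℕ) : ℤ) ∣ Q.2.1 ^ 2 - NumberField.discr K := by
    obtain ⟨hdisc, -, hA, -⟩ := hQ
    rw [← hdisc]
    obtain ⟨k, hk⟩ := hA
    exact ⟨k * Q.2.2, by rw [hk]; ring⟩
  obtain ⟨HD, hHDβ⟩ := exists_heegnerDatum 32 hK.discr_neg hβ
  obtain ⟨Pt, θ, hPt, htrans⟩ := heegnerPoints_shimuraReciprocity_holds 32 curveA K hK hSH Dt HD ι
  obtain ⟨q₀, hq₀, hQq₀⟩ := HD.exists_isGamma0Equiv Q hQ (by rw [hHDβ])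
  -- the bridge
  obtain ⟨ψ, hψ⟩ := exists_algEquiv_singularModuliField_coe_eq hK ι h𝔪 e he
  set P' := WeierstrassCurve.Affine.Point.map (W' := curveA) (ψ : hilbertClassField K →ₐ[K] singularModuliField K ι) P with hP'def
  have hP' : P' = Pt ⟨q₀, hq₀⟩ := by
    apply WeierstrassCurve.Affine.Point.map_injective (f := (singularModuliField K ι).subtype.toRatAlgHom)
    have e1 := map_eq_map_of_apply_eq curveA (ψ : hilbertClassField K →ₐ[K] singularModuliField K ι) (singularModuliField K ι).subtype
      (e.comp (IntermediateField.inclusion (hilbertClassField_le_rayClassField h𝔪)).toRingHom) (fun a => hψ a) P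
    rw [hPt ⟨q₀, hq₀⟩, hP'def]
    exact e1.trans (hP.trans (φ_eq_of_isGamma0Equiv Dt hQq₀))
  -- `σ* = ψ σ ψ⁻¹` fixes `Pt q₀`
  set σ' : singularModuliField K ι ≃ₐ[K] singularModuliField K ι := ψ.symm.trans (σ.trans ψ) with hσ'def
  have hσ' : WeierstrassCurve.Affine.Point.map (W' := curveA) (σ' : singularModuliField K ι →ₐ[K] singularModuliField K ι) (Pt ⟨q₀, hq₀⟩) = Pt ⟨q₀, hq₀⟩ := by
    rw [← hP', hP'def]
    have e1 := map_map_algHom curveA (ψ : hilbertClassField K →ₐ[K] singularModuliField K ι)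
      (σ' : singularModuliField K ι →ₐ[K] singularModuliField K ι) P
    have e2 := map_map_algHom curveA (σ : hilbertClassField K →ₐ[K] hilbertClassField K)
      (ψ : hilbertClassField K →ₐ[K] singularModuliField K ι) P
    have hc : (σ' : singularModuliField K ι →ₐ[K] singularModuliField K ι).comp (ψ : hilbertClassField K →ₐ[K] singularModuliField K ι) =
        (ψ : hilbertClassField K →ₐ[K] singularModuliField K ι).comp (σ : hilbertClassField K →ₐ[K] hilbertClassField K) :=
      AlgHom.ext fun x => by simp [hσ'def]
    rw [hc] at e1
    exact e1.trans (e2.symm.trans (congrArg _ hσ))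
  -- `σ* = θ γ`; the translate `q'` has the same point, hence `q' = q₀`, hence `γ = 1`
  obtain ⟨γ, hγ⟩ := θ.surjective σ'
  obtain ⟨q', hcl, hmap⟩ := htrans γ ⟨q₀, hq₀⟩
  rw [hγ, hσ'] at hmap
  have hφeq : Dt.φ (heegnerTau (q₀ : ℤ × ℤ × ℤ)) = Dt.φ (heegnerTau (q' : ℤ × ℤ × ℤ)) := by
    rw [← hPt ⟨q₀, hq₀⟩, ← hPt q', hmap]
  have hqq : (q' : ℤ × ℤ × ℤ) = q₀ := by
    by_contra hne
    exact HD.pairwise_not_isGamma0Equiv (Finset.mem_coe.mpr q'.2) (Finset.mem_coe.mpr hq₀) hne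
      (isGamma0Equiv_of_φ_eq hInj Dt hdeg hφeq.symm)
  have hγ1 : γ = 1 := by
    have h := hcl
    rw [hqq] at h
    exact mul_eq_right.mp h.symm
  rw [hγ1, map_one] at hγ
  -- `σ' = 1`, hence `σ = 1`
  apply AlgEquiv.ext
  intro h
  have key : σ' (ψ h) = ψ (σ h) := by simp [hσ'def]
  rw [← hγ, AlgEquiv.one_apply] at key
  have := congrArg ψ.symm key
  rw [AlgEquiv.symm_apply_apply, AlgEquiv.symm_apply_apply] at this
  rw [AlgEquiv.one_apply]
  exact this.symm

end Summit.BirchSwinnertonDyer.PrintCf2.TheoremAHeegnerFree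

end
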